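import Summits.CriticalPhenomena.Ising3DConformalLimit.Theorems.HyperoctahedralRPExistsScaleCovariantLimitOrbitPrecompactOfTwoPointLaw
import Summits.CriticalPhenomena.Ising3DConformalLimit.Theorems.HyperoctahedralRPExistsScaleCovariantLimitLocallyBoundedOfPairBound
import Summits.CriticalPhenomena.Ising3DConformalLimit.Theorems.HyperoctahedralRPExistsScaleCovariantLimitSepMoveOfPairRegularity
import Summits.CriticalPhenomena.Ising3DConformalLimit.Theorems.HyperoctahedralRPExistsScaleCovariantLimitOrbitPrecompactOfPairRegularity
import Summits.CriticalPhenomena.Ising3DConformalLimit.Theorems.HyperoctahedralRPExistsScaleCovariantLimitPairEquicontOfSeparableHoelder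
import Summits.CriticalPhenomena.Ising3DConformalLimit.Theorems.HyperoctahedralRPExistsScaleCovariantLimitUniformRegularityOfOrbitPrecompact
import Summits.CriticalPhenomena.Ising3DConformalLimit.Theorems.HyperoctahedralRPExistsScaleCovariantLimitTwoPointDoublingOfOrbitPrecompact
import Summits.CriticalPhenomena.Ising3DConformalLimit.Theorems.HyperoctahedralRPExistsScaleCovariantLimitCruxIffOrbitPrecompactPointwiseLimit
import Summits.CriticalPhenomena.Ising3DConformalLimit.Theorems.HyperoctahedralRPExistsScaleCovariantLimitRegularityGivesPrecompact
import Summits.CriticalPhenomena.Ising3DConformalLimit.Theorems.MirrorHoelderCompactnessRescaledBounds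
import HarnessLib

/-!
# Item maps of the compactness half of the crux `ExistsScaleCovariantLimit`, IMPORTABLE
(line `Sketch`, crux item stmt-CriticalPhenomena-1981, route `HyperoctahedralRP`; registered anchor `stub_compactnessItemMaps`; lead c4,
2026-08-16)

Compositions of landed modules only (T1 p117316, F1 p117882, F2 p117883, F3 p117884, F4 p117936, UR′ p115855, D p111525, IM p116283,
S6 p98883, item 6157 `rescaledBounds_proof`) — the same theorems are proved inside the registered skeleton
`Cruxes/ExistsScaleCovariantLimit/Lines/Sketch.lean`; here they become importable (namespace `…TwoHierarchies.ItemMaps`):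
* `orbitPrecompact_of_pairRegularity` — **PairRegularity ⟹ item 5955**, PairRegularity := item 4658 `UniformRegularity` RESTRICTED TO
  ORDER TWO (clauses (a), (b) at `n = 2` and (c), written with `ρ_pin` = the inline `ρ★` of 4658);
* `orbitPrecompact_iff_pairRegularity`, `uniformRegularity_iff_pairRegularity` — **item 5955 ⟺ item 4658 ⟺ PairRegularity**: the
  compactness half of the 3D-Ising existence problem is a statement about the critical TWO-point function (reflection positivity transports
  regularity up the orders: crux 1344's pedigree machinery re-run on pair bounds + pair equicontinuity, F1–F3);
* `orbitPrecompact_of_doubling_separableHoelder`, `orbitPrecompact_iff_doubling_of_separableHoelder`,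
  `uniformRegularity_iff_doubling_of_separableHoelder` — **items 6150 ∧ 6151 ⟹ 5955**, and **under item 6151, 5955 ⟺ 4658 ⟺ 6150**
  (route `MirrorHoelderCompactness`'s chain WITHOUT its open item 6152: at order two every pair is coordinate-separable, F4);
* `uniformRegularity_of_twoPointLaw`, `crux_iff_pointwiseLimit_of_twoPointLaw` — item 0634 ⟹ 4658; under 0634, crux ⟺ item 6153;
* `crux_iff_pairRegularity_and_pointwiseLimit`, `crux_iff_doubling_and_pointwiseLimit_of_separableHoelder` — the crux as
  PairRegularity ∧ 6153, and (under 6151) as 6150 ∧ 6153;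
* `stub_compactnessItemMaps` — the registered package.

References: H. Duminil-Copin, ICM 2022 §8.4 [DuminilCopinICM2022]; M. Aizenman, H. Duminil-Copin, Ann. Math. 194 (2021) §5–6
[AizenmanDuminilCopinAnnals2021]. No definitions, no `sorry`.
-/

noncomputable section

namespace Summit.CriticalPhenomena.Ising3DConformalLimit.Cruxes.ExistsScaleCovariantLimit.TwoHierarchies.ItemMaps

open Literature.Probability.LatticeModels Filter Set
open scoped Topology
open Summit.CriticalPhenomena.Ising3DConformalLimit.MoebiusLimitExistsOnlyInteraction (rhoPin)
open Summit.CriticalPhenomena.Ising3DConformalLimit.Cruxes.ExistsScaleCovariantLimit.TwoHierarchies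
open Summit.CriticalPhenomena.Ising3DConformalLimit.Theses

/-- A sequence tending to `0⁺` is eventually in `(0, δ₀)`. [folklore] -/
theorem eventually_mem_Ioo_of_tendsto_nhdsGT' {u : ℕ → ℝ} (hu : Tendsto u atTop (𝓝[>] (0 : ℝ)))
    {δ₀ : ℝ} (hδ₀ : 0 < δ₀) : ∀ᶠ k in atTop, u k ∈ Set.Ioo 0 δ₀ := by
  have h1 : ∀ᶠ k in atTop, 0 < u k := (tendsto_nhdsWithin_iff.1 hu).2
  have h2 : ∀ᶠ k in atTop, u k < δ₀ := (tendsto_nhdsWithin_iff.1 hu).1.eventually (gt_mem_nhds hδ₀)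
  filter_upwards [h1, h2] with k hk1 hk2
  exact ⟨hk1, hk2⟩

/-- **`PairRegularity` ⟹ item 5955**: uniform regularity of the pinned PAIR zoom alone (clauses (a), (b) at order two and (c) of item 4658,
with `ρ_pin`) gives precompactness of the full critical zoom orbit. The `δ`-uniform clauses give their sequential forms along every
`u k → 0⁺`, F1 (`stub_locallyBounded_of_pairBound`) turns pair bounds into local bounds at every order, F2
(`stub_sepMove_of_pairRegularity`) supplies the base case of the pedigree induction, F3 (`stub_orbitPrecompact_of_pairRegularity_of`)
assembles. [cite: DuminilCopinICM2022, §8.4 p. 29] -/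
theorem orbitPrecompact_of_pairRegularity
    (hPR : (∀ K : Set (Fin 2 → EuclideanSpace ℝ (Fin 3)), K ⊆ NonCoincident 3 2 → IsCompact K →
        ∃ M δ₀ : ℝ, 0 < δ₀ ∧ ∀ δ ∈ Set.Ioo 0 δ₀, ∀ x ∈ K,
          |rescaledCorrelator (criticalCorr 3) rhoPin 2 δ x| ≤ M) ∧
      (∀ K : Set (Fin 2 → EuclideanSpace ℝ (Fin 3)), K ⊆ NonCoincident 3 2 → IsCompact K →
        ∀ ε : ℝ, 0 < ε → ∃ r δ₀ : ℝ, 0 < r ∧ 0 < δ₀ ∧ ∀ δ ∈ Set.Ioo 0 δ₀, ∀ x ∈ K, ∀ y ∈ K, dist x y < r →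
          |rescaledCorrelator (criticalCorr 3) rhoPin 2 δ x - rescaledCorrelator (criticalCorr 3) rhoPin 2 δ y| < ε) ∧
      (∀ K : Set (Fin 2 → EuclideanSpace ℝ (Fin 3)), K ⊆ NonCoincident 3 2 → IsCompact K →
        ∃ m δ₀ : ℝ, 0 < m ∧ 0 < δ₀ ∧ ∀ δ ∈ Set.Ioo 0 δ₀, ∀ x ∈ K,
          m ≤ rescaledCorrelator (criticalCorr 3) rhoPin 2 δ x)) :
    MonotoneRG.OrbitPrecompact := by
  obtain ⟨ha, hb, hc⟩ := hPR
  have hB : ∀ u : ℕ → ℝ, Tendsto u atTop (𝓝[>] (0 : ℝ)) →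
      ∀ K : Set (Fin 2 → EuclideanSpace ℝ (Fin 3)), IsCompact K → K ⊆ NonCoincident 3 2 →
        ∃ M : ℝ, ∀ᶠ k in atTop, ∀ x ∈ K, |rescaledCorrelator (criticalCorr 3) rhoPin 2 (u k) x| ≤ M := by
    intro u hu K hK hKs
    obtain ⟨M, δ₀, hδ₀, hM⟩ := ha K hKs hK
    exact ⟨M, (eventually_mem_Ioo_of_tendsto_nhdsGT' hu hδ₀).mono fun k hk x hx => hM _ hk x hx⟩
  have hE : ∀ u : ℕ → ℝ, Tendsto u atTop (𝓝[>] (0 : ℝ)) →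
      ∀ K : Set (Fin 2 → EuclideanSpace ℝ (Fin 3)), IsCompact K → K ⊆ NonCoincident 3 2 →
        ∀ ε > 0, ∃ η > 0, ∀ᶠ k in atTop, ∀ x ∈ K, ∀ y ∈ K, dist x y < η →
          |rescaledCorrelator (criticalCorr 3) rhoPin 2 (u k) x -
            rescaledCorrelator (criticalCorr 3) rhoPin 2 (u k) y| < ε := by
    intro u hu K hK hKs ε hε
    obtain ⟨r, δ₀, hr, hδ₀, h⟩ := hb K hKs hK ε hε
    exact ⟨r, hr, (eventually_mem_Ioo_of_tendsto_nhdsGT' hu hδ₀).mono fun k hk x hx y hy hxy =>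
      h _ hk x hx y hy hxy⟩
  have hC : ∀ u : ℕ → ℝ, Tendsto u atTop (𝓝[>] (0 : ℝ)) →
      ∀ x ∈ NonCoincident 3 2, ∃ m : ℝ, 0 < m ∧
        ∀ᶠ k in atTop, m ≤ rescaledCorrelator (criticalCorr 3) rhoPin 2 (u k) x := by
    intro u hu x hx
    obtain ⟨m, δ₀, hm, hδ₀, h⟩ := hc {x} (Set.singleton_subset_iff.2 hx) isCompact_singleton
    exact ⟨m, hm, (eventually_mem_Ioo_of_tendsto_nhdsGT' hu hδ₀).mono fun k hk => h _ hk x rfl⟩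
  have hLB := stub_locallyBounded_of_pairBound hB
  exact stub_orbitPrecompact_of_pairRegularity_of hLB (stub_sepMove_of_pairRegularity hLB hE) hE hC

/-- **Item 4658 ⟹ `PairRegularity`**: restriction of `UniformRegularity` to order two (`ρ★ = ρ_pin`). [folklore] -/
theorem pairRegularity_of_uniformRegularity (h : MonotoneRG.UniformRegularity) :
    (∀ K : Set (Fin 2 → EuclideanSpace ℝ (Fin 3)), K ⊆ NonCoincident 3 2 → IsCompact K →
        ∃ M δ₀ : ℝ, 0 < δ₀ ∧ ∀ δ ∈ Set.Ioo 0 δ₀, ∀ x ∈ K,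
          |rescaledCorrelator (criticalCorr 3) rhoPin 2 δ x| ≤ M) ∧
      (∀ K : Set (Fin 2 → EuclideanSpace ℝ (Fin 3)), K ⊆ NonCoincident 3 2 → IsCompact K →
        ∀ ε : ℝ, 0 < ε → ∃ r δ₀ : ℝ, 0 < r ∧ 0 < δ₀ ∧ ∀ δ ∈ Set.Ioo 0 δ₀, ∀ x ∈ K, ∀ y ∈ K, dist x y < r →
          |rescaledCorrelator (criticalCorr 3) rhoPin 2 δ x - rescaledCorrelator (criticalCorr 3) rhoPin 2 δ y| < ε) ∧
      (∀ K : Set (Fin 2 → EuclideanSpace ℝ (Fin 3)), K ⊆ NonCoincident 3 2 → IsCompact K →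
        ∃ m δ₀ : ℝ, 0 < m ∧ 0 < δ₀ ∧ ∀ δ ∈ Set.Ioo 0 δ₀, ∀ x ∈ K,
          m ≤ rescaledCorrelator (criticalCorr 3) rhoPin 2 δ x) := by
  obtain ⟨hab, hc⟩ := h
  rw [rhoStar_eq_rhoPin] at hab hc
  exact ⟨fun K hKs hK => (hab 2 K hKs hK).1, fun K hKs hK => (hab 2 K hKs hK).2, hc⟩

/-- **ITEM 5955 ⟺ `PairRegularity`**: precompactness of the critical zoom orbit of ALL orders is EQUIVALENT to uniform regularity of the
pinned PAIR zoom — the compactness half of the existence crux is a statement about the critical two-point function only.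
[cite: DuminilCopinICM2022, §8.4 p. 29] -/
theorem orbitPrecompact_iff_pairRegularity :
    MonotoneRG.OrbitPrecompact ↔
    ((∀ K : Set (Fin 2 → EuclideanSpace ℝ (Fin 3)), K ⊆ NonCoincident 3 2 → IsCompact K →
        ∃ M δ₀ : ℝ, 0 < δ₀ ∧ ∀ δ ∈ Set.Ioo 0 δ₀, ∀ x ∈ K,
          |rescaledCorrelator (criticalCorr 3) rhoPin 2 δ x| ≤ M) ∧
      (∀ K : Set (Fin 2 → EuclideanSpace ℝ (Fin 3)), K ⊆ NonCoincident 3 2 → IsCompact K →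
        ∀ ε : ℝ, 0 < ε → ∃ r δ₀ : ℝ, 0 < r ∧ 0 < δ₀ ∧ ∀ δ ∈ Set.Ioo 0 δ₀, ∀ x ∈ K, ∀ y ∈ K, dist x y < r →
          |rescaledCorrelator (criticalCorr 3) rhoPin 2 δ x - rescaledCorrelator (criticalCorr 3) rhoPin 2 δ y| < ε) ∧
      (∀ K : Set (Fin 2 → EuclideanSpace ℝ (Fin 3)), K ⊆ NonCoincident 3 2 → IsCompact K →
        ∃ m δ₀ : ℝ, 0 < m ∧ 0 < δ₀ ∧ ∀ δ ∈ Set.Ioo 0 δ₀, ∀ x ∈ K,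
          m ≤ rescaledCorrelator (criticalCorr 3) rhoPin 2 δ x)) :=
  ⟨fun h => pairRegularity_of_uniformRegularity (stub_uniformRegularity_of_orbitPrecompact h),
    orbitPrecompact_of_pairRegularity⟩

/-- **ITEM 4658 ⟺ ITS OWN ORDER-TWO CASE**: uniform regularity of the pinned zoom at ALL orders follows from uniform regularity of
the PAIR zoom (UR′ p115855 and the landed `stub_regularityGivesPrecompact`). [cite: DuminilCopinICM2022, §8.4 p. 29] -/
theorem uniformRegularity_iff_pairRegularity :
    MonotoneRG.UniformRegularity ↔
    ((∀ K : Set (Fin 2 → EuclideanSpace ℝ (Fin 3)), K ⊆ NonCoincident 3 2 → IsCompact K →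
        ∃ M δ₀ : ℝ, 0 < δ₀ ∧ ∀ δ ∈ Set.Ioo 0 δ₀, ∀ x ∈ K,
          |rescaledCorrelator (criticalCorr 3) rhoPin 2 δ x| ≤ M) ∧
      (∀ K : Set (Fin 2 → EuclideanSpace ℝ (Fin 3)), K ⊆ NonCoincident 3 2 → IsCompact K →
        ∀ ε : ℝ, 0 < ε → ∃ r δ₀ : ℝ, 0 < r ∧ 0 < δ₀ ∧ ∀ δ ∈ Set.Ioo 0 δ₀, ∀ x ∈ K, ∀ y ∈ K, dist x y < r →
          |rescaledCorrelator (criticalCorr 3) rhoPin 2 δ x - rescaledCorrelator (criticalCorr 3) rhoPin 2 δ y| < ε) ∧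
      (∀ K : Set (Fin 2 → EuclideanSpace ℝ (Fin 3)), K ⊆ NonCoincident 3 2 → IsCompact K →
        ∃ m δ₀ : ℝ, 0 < m ∧ 0 < δ₀ ∧ ∀ δ ∈ Set.Ioo 0 δ₀, ∀ x ∈ K,
          m ≤ rescaledCorrelator (criticalCorr 3) rhoPin 2 δ x)) :=
  ⟨pairRegularity_of_uniformRegularity,
    fun h => stub_uniformRegularity_of_orbitPrecompact (orbitPrecompact_of_pairRegularity h)⟩

/-- **Items 6150 ∧ 6151 ⟹ item 5955**: all-scale axis doubling and the separable Hölder modulus give precompactness of the critical zoom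
orbit at ALL orders — route `MirrorHoelderCompactness`'s chain WITHOUT its open item 6152 (clauses (a), (c) by `rescaledBounds_proof`,
item 6157; clause (b) at order two by F4 `stub_pairEquicont_of_separableHoelder`).
[cite: AizenmanDuminilCopinAnnals2021, arXiv:1912.07973 Remark 5.10 and Def. 5.11] -/
theorem orbitPrecompact_of_doubling_separableHoelder (hD : MirrorHoelderCompactness.TwoPointDoubling)
    (hSH : MirrorHoelderCompactness.SeparableHoelder) : MonotoneRG.OrbitPrecompact := by
  obtain ⟨ha, hc⟩ := MirrorHoelderCompactnessRescaledBounds.rescaledBounds_proof hD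
  rw [rhoStar_eq_rhoPin] at ha hc
  exact orbitPrecompact_of_pairRegularity ⟨fun K hKs hK => ha 2 K hKs hK,
    stub_pairEquicont_of_separableHoelder hD hSH, hc⟩

/-- **UNDER ITEM 6151, ITEM 5955 ⟺ ITEM 6150**: given the separable Hölder modulus, precompactness of the critical zoom orbit at all
orders is EQUIVALENT to all-scale axis doubling `κ g(n) ≤ g(2n)` of the critical two-point function (`⟹` is the landed D p111525).
[cite: AizenmanDuminilCopinAnnals2021, arXiv:1912.07973 Remark 5.10 and Def. 5.11] -/
theorem orbitPrecompact_iff_doubling_of_separableHoelder (hSH : MirrorHoelderCompactness.SeparableHoelder) :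
    MonotoneRG.OrbitPrecompact ↔ MirrorHoelderCompactness.TwoPointDoubling :=
  ⟨stub_twoPointDoubling_of_orbitPrecompact, fun hD => orbitPrecompact_of_doubling_separableHoelder hD hSH⟩

/-- **ITEM 5955 ⟺ ITEM 4658** (UR′ and `stub_regularityGivesPrecompact`). [folklore] -/
theorem orbitPrecompact_iff_uniformRegularity : MonotoneRG.OrbitPrecompact ↔ MonotoneRG.UniformRegularity :=
  ⟨stub_uniformRegularity_of_orbitPrecompact, stub_regularityGivesPrecompact⟩

/-- **UNDER ITEM 6151, ITEM 4658 ⟺ ITEM 6150.** [folklore] -/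
theorem uniformRegularity_iff_doubling_of_separableHoelder (hSH : MirrorHoelderCompactness.SeparableHoelder) :
    MonotoneRG.UniformRegularity ↔ MirrorHoelderCompactness.TwoPointDoubling := by
  rw [← orbitPrecompact_iff_uniformRegularity, orbitPrecompact_iff_doubling_of_separableHoelder hSH]

/-- **Item 0634 ⟹ item 4658** (T1 `stub_orbitPrecompact_of_twoPointLaw` with UR′). [cite: DuminilCopinICM2022, §8.4 p. 29] -/
theorem uniformRegularity_of_twoPointLaw (h0634 : IsingEuclidUpgrade.IsingEuclidUpgradeR2RotInvPowerLaw) :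
    MonotoneRG.UniformRegularity :=
  stub_uniformRegularity_of_orbitPrecompact (stub_orbitPrecompact_of_twoPointLaw h0634)

/-- **Under item 0634 the crux is item 6153 `PointwiseLimit`** (T1 with the landed IM `stub_cruxIffOrbitPrecompactPointwiseLimit`).
[cite: DuminilCopinICM2022, §8.4 p. 29] -/
theorem crux_iff_pointwiseLimit_of_twoPointLaw (h0634 : IsingEuclidUpgrade.IsingEuclidUpgradeR2RotInvPowerLaw) :
    HyperoctahedralRP.ExistsScaleCovariantLimit ↔ MirrorHoelderCompactness.PointwiseLimit := by
  rw [stub_cruxIffOrbitPrecompactPointwiseLimit]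
  exact ⟨fun h => h.2, fun h => ⟨stub_orbitPrecompact_of_twoPointLaw h0634, h⟩⟩

/-- **crux ⟺ `PairRegularity` ∧ item 6153**: existence of the scale-covariant limit = uniform regularity of the TWO-point zoom +
full-filter pointwise convergence of the pinned zoom (IM with `orbitPrecompact_iff_pairRegularity`). [cite: DuminilCopinICM2022, §8.4 p. 29] -/
theorem crux_iff_pairRegularity_and_pointwiseLimit :
    HyperoctahedralRP.ExistsScaleCovariantLimit ↔
    (((∀ K : Set (Fin 2 → EuclideanSpace ℝ (Fin 3)), K ⊆ NonCoincident 3 2 → IsCompact K →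
        ∃ M δ₀ : ℝ, 0 < δ₀ ∧ ∀ δ ∈ Set.Ioo 0 δ₀, ∀ x ∈ K,
          |rescaledCorrelator (criticalCorr 3) rhoPin 2 δ x| ≤ M) ∧
      (∀ K : Set (Fin 2 → EuclideanSpace ℝ (Fin 3)), K ⊆ NonCoincident 3 2 → IsCompact K →
        ∀ ε : ℝ, 0 < ε → ∃ r δ₀ : ℝ, 0 < r ∧ 0 < δ₀ ∧ ∀ δ ∈ Set.Ioo 0 δ₀, ∀ x ∈ K, ∀ y ∈ K, dist x y < r →
          |rescaledCorrelator (criticalCorr 3) rhoPin 2 δ x - rescaledCorrelator (criticalCorr 3) rhoPin 2 δ y| < ε) ∧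
      (∀ K : Set (Fin 2 → EuclideanSpace ℝ (Fin 3)), K ⊆ NonCoincident 3 2 → IsCompact K →
        ∃ m δ₀ : ℝ, 0 < m ∧ 0 < δ₀ ∧ ∀ δ ∈ Set.Ioo 0 δ₀, ∀ x ∈ K,
          m ≤ rescaledCorrelator (criticalCorr 3) rhoPin 2 δ x)) ∧
    MirrorHoelderCompactness.PointwiseLimit) := by
  rw [stub_cruxIffOrbitPrecompactPointwiseLimit, orbitPrecompact_iff_pairRegularity]

/-- **Under item 6151: crux ⟺ item 6150 ∧ item 6153** — existence = axis doubling + full-filter pointwise convergence.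
[cite: DuminilCopinICM2022, §8.4 p. 29] -/
theorem crux_iff_doubling_and_pointwiseLimit_of_separableHoelder (hSH : MirrorHoelderCompactness.SeparableHoelder) :
    HyperoctahedralRP.ExistsScaleCovariantLimit ↔
      (MirrorHoelderCompactness.TwoPointDoubling ∧ MirrorHoelderCompactness.PointwiseLimit) := by
  rw [stub_cruxIffOrbitPrecompactPointwiseLimit, orbitPrecompact_iff_doubling_of_separableHoelder hSH]

/-- **Registered anchor `stub_compactnessItemMaps`** — the package: item 5955 ⟺ PairRegularity, item 4658 ⟺ PairRegularity, and under
item 6151: 5955 ⟺ 6150. [cite: DuminilCopinICM2022, §8.4 p. 29] -/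
theorem stub_compactnessItemMaps :
    (MonotoneRG.OrbitPrecompact ↔
      ((∀ K : Set (Fin 2 → EuclideanSpace ℝ (Fin 3)), K ⊆ NonCoincident 3 2 → IsCompact K →
          ∃ M δ₀ : ℝ, 0 < δ₀ ∧ ∀ δ ∈ Set.Ioo 0 δ₀, ∀ x ∈ K,
            |rescaledCorrelator (criticalCorr 3) rhoPin 2 δ x| ≤ M) ∧
        (∀ K : Set (Fin 2 → EuclideanSpace ℝ (Fin 3)), K ⊆ NonCoincident 3 2 → IsCompact K →
          ∀ ε : ℝ, 0 < ε → ∃ r δ₀ : ℝ, 0 < r ∧ 0 < δ₀ ∧ ∀ δ ∈ Set.Ioo 0 δ₀, ∀ x ∈ K, ∀ y ∈ K, dist x y < r →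
            |rescaledCorrelator (criticalCorr 3) rhoPin 2 δ x - rescaledCorrelator (criticalCorr 3) rhoPin 2 δ y| < ε) ∧
        (∀ K : Set (Fin 2 → EuclideanSpace ℝ (Fin 3)), K ⊆ NonCoincident 3 2 → IsCompact K →
          ∃ m δ₀ : ℝ, 0 < m ∧ 0 < δ₀ ∧ ∀ δ ∈ Set.Ioo 0 δ₀, ∀ x ∈ K,
            m ≤ rescaledCorrelator (criticalCorr 3) rhoPin 2 δ x))) ∧
    (MonotoneRG.OrbitPrecompact ↔ MonotoneRG.UniformRegularity) ∧
    (MirrorHoelderCompactness.SeparableHoelder → (MonotoneRG.OrbitPrecompact ↔ MirrorHoelderCompactness.TwoPointDoubling)) :=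
  ⟨orbitPrecompact_iff_pairRegularity, orbitPrecompact_iff_uniformRegularity, orbitPrecompact_iff_doubling_of_separableHoelder⟩

end Summit.CriticalPhenomena.Ising3DConformalLimit.Cruxes.ExistsScaleCovariantLimit.TwoHierarchies.ItemMaps

end
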